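import Mathlib.Combinatorics.SimpleGraph.Connectivity.Connected
import HarnessLib

/-!
# Excursion decomposition of open walks at a family of inner sets (proved)

Topic `Literature/Probability/Percolation`. Deterministic walk surgery behind "the connection
pattern of small inner balls is read on the crossing clusters of the surrounding annuli"
(Kesten-type arm-separation / gluing arguments; Camia–Newman, Camia–Feng even-pattern events).

Abstract setting: a vertex type `V`; three simple graphs `G ≤ H` ("open" edges among "lattice"
edges) and `R` (the open edges with BOTH endpoints outside the inner sets); a family of pairwise
far-apart INNER sets `I k` with FAR sets `F k` (the complement of the outer ball of index `k`);
`O` = the vertices outside every inner set. A CROSSING SITE of index `k` (`Crs k x`) is a vertex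
of `O` that is `H`-adjacent to `I k` and `R`-joined to a far vertex of `O ∩ F k`. UNIQUENESS
(`hUni`) says all crossing sites of one index are `R`-joined. The predicates `O` and `Crs` are
taken as parameters characterised by `hO`, `hCrs` (no definitions are introduced here).

Results: `exists_crs_of_walk_firstEntry` (a walk entering `I i` from outside passes a crossing
site of `i`), `exists_crs_mem_support_of_walk_far` (an arm from `I i` to `F i` passes a crossing
site of `i`), `exists_crs_pair_of_walk` (under uniqueness, a walk from `I j` to `I i`, `j ≠ i`,
yields `R`-joined crossing sites of `i` and `j`), and the two transfer statements
`reachable_points_iff_crs` / `reachable_inner_iff_crs`: given arms and uniqueness, connection of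
the inner sets (or of chosen points in them) by `G` coincides with `R`-connection of crossing
sites. Everything is proved; no definitions. [folklore]
-/

namespace Literature.Probability.Percolation

open SimpleGraph

variable {V ι : Type*} {G H R : SimpleGraph V} {I F : ι → Set V} {O : Set V} {Crs : ι → V → Prop}

section Excursions

/-- If index `m` is linked to index `j` (equal, or joined through a pair of crossing sites) and
all crossing sites of one index are `R`-joined, then every crossing site of `m` is `R`-joined to a
crossing site of `j`. [folklore] -/
theorem exists_crs_reachable_of_linked
    (hUni : ∀ k x x', Crs k x → Crs k x' → R.Reachable x x') {j m : ι} {e' : V}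
    (hlink : m = j ∨ ∃ x'' e, Crs j x'' ∧ Crs m e ∧ R.Reachable x'' e) (he' : Crs m e') :
    ∃ x'', Crs j x'' ∧ R.Reachable x'' e' := by
  rcases hlink with rfl | ⟨x'', e, hx'', he, hRe⟩
  · exact ⟨e', he', Reachable.refl _⟩
  · exact ⟨x'', hx'', hRe.trans (hUni m e e' he he')⟩

/-- A vertex `H`-adjacent to the inner set `I i` lies in no other inner set, hence (if it is not
in `I i`) it lies in `O`. [folklore] -/
theorem mem_out_of_adj_inner (hO : ∀ x, x ∈ O ↔ ∀ k, x ∉ I k)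
    (hIF : ∀ k x, x ∈ I k → x ∈ F k → False)
    (hrim : ∀ ⦃k m : ι⦄, k ≠ m → ∀ ⦃x y : V⦄, H.Adj x y → y ∈ I m → x ∈ F k)
    {i : ι} {u u' : V} (h : H.Adj u u') (hu' : u' ∈ I i) (hu : u ∉ I i) : u ∈ O := by
  rw [hO]
  intro k hk
  by_cases hki : k = i
  · exact hu (hki ▸ hk)
  · exact hIF k u hk (hrim hki h hu')

/-- **First entry of a walk into an inner set passes a crossing site.** A `G`-walk ending in
`I i`, starting outside `I i` at a vertex which, if it lies in `O`, is `R`-joined to a far vertex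
of `O ∩ F i`, contains a crossing site of index `i`. [folklore] -/
theorem exists_crs_of_walk_firstEntry (hGH : G ≤ H)
    (hR : ∀ ⦃a b : V⦄, G.Adj a b → a ∈ O → b ∈ O → R.Adj a b)
    (hO : ∀ x, x ∈ O ↔ ∀ k, x ∉ I k) (hIF : ∀ k x, x ∈ I k → x ∈ F k → False)
    (hrim : ∀ ⦃k m : ι⦄, k ≠ m → ∀ ⦃x y : V⦄, H.Adj x y → y ∈ I m → x ∈ F k)
    (hCrs : ∀ k x, Crs k x ↔
      x ∈ O ∧ (∃ y, y ∈ I k ∧ H.Adj x y) ∧ ∃ y, y ∈ O ∧ y ∈ F k ∧ R.Reachable x y)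
    (i : ι) : ∀ {u v : V} (W : G.Walk u v), v ∈ I i → u ∉ I i →
      (u ∈ O → ∃ y, y ∈ O ∧ y ∈ F i ∧ R.Reachable u y) → ∃ a ∈ W.support, Crs i a := by
  intro u v W
  induction W with
  | nil => exact fun hv hu _ => (hu hv).elim
  | cons h W' ih =>
    rename_i u u' v
    intro hv hu hfar
    by_cases hu'i : u' ∈ I i
    · have huO : u ∈ O := mem_out_of_adj_inner hO hIF hrim (hGH h) hu'i hu
      obtain ⟨y, hyO, hyF, huy⟩ := hfar huO
      exact ⟨u, by simp, (hCrs i u).2 ⟨huO, ⟨u', hu'i, hGH h⟩, y, hyO, hyF, huy⟩⟩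
    · have hfar' : u' ∈ O → ∃ y, y ∈ O ∧ y ∈ F i ∧ R.Reachable u' y := by
        intro hu'O
        by_cases huO : u ∈ O
        · obtain ⟨y, hyO, hyF, huy⟩ := hfar huO
          exact ⟨y, hyO, hyF, (hR h.symm hu'O huO).reachable.trans huy⟩
        · rw [hO] at huO
          push Not at huO
          obtain ⟨m, hm⟩ := huO
          have hmi : i ≠ m := fun him => hu (him ▸ hm)
          exact ⟨u', hu'O, hrim hmi (hGH h.symm) hm, Reachable.refl _⟩
      obtain ⟨a, ha, hCa⟩ := ih hv hu'i hfar'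
      exact ⟨a, by simp [ha], hCa⟩

/-- **An arm passes a crossing site.** A `G`-walk from the inner set `I i` to the far set `F i`
contains a crossing site of index `i`. [folklore] -/
theorem exists_crs_mem_support_of_walk_far (hGH : G ≤ H)
    (hR : ∀ ⦃a b : V⦄, G.Adj a b → a ∈ O → b ∈ O → R.Adj a b)
    (hO : ∀ x, x ∈ O ↔ ∀ k, x ∉ I k) (hIF : ∀ k x, x ∈ I k → x ∈ F k → False)
    (hrim : ∀ ⦃k m : ι⦄, k ≠ m → ∀ ⦃x y : V⦄, H.Adj x y → y ∈ I m → x ∈ F k)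
    (hCrs : ∀ k x, Crs k x ↔
      x ∈ O ∧ (∃ y, y ∈ I k ∧ H.Adj x y) ∧ ∃ y, y ∈ O ∧ y ∈ F k ∧ R.Reachable x y)
    {i : ι} {u v : V} (W : G.Walk u v) (hu : u ∈ I i) (hv : v ∈ F i) :
    ∃ a ∈ W.support, Crs i a := by
  obtain ⟨a, ha, hCa⟩ := exists_crs_of_walk_firstEntry hGH hR hO hIF hrim hCrs i W.reverse hu
    (fun hvI => hIF i v hvI hv) (fun hvO => ⟨v, hvO, hv, Reachable.refl _⟩)
  exact ⟨a, by simpa using ha, hCa⟩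

/-- Inductive form of `exists_crs_pair_of_walk`: the invariant carried along a walk heading to its
first vertex in `I i`. [folklore] -/
theorem exists_crs_pair_of_walk_aux (hGH : G ≤ H)
    (hR : ∀ ⦃a b : V⦄, G.Adj a b → a ∈ O → b ∈ O → R.Adj a b)
    (hO : ∀ x, x ∈ O ↔ ∀ k, x ∉ I k) (hIF : ∀ k x, x ∈ I k → x ∈ F k → False)
    (hrim : ∀ ⦃k m : ι⦄, k ≠ m → ∀ ⦃x y : V⦄, H.Adj x y → y ∈ I m → x ∈ F k)
    (hCrs : ∀ k x, Crs k x ↔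
      x ∈ O ∧ (∃ y, y ∈ I k ∧ H.Adj x y) ∧ ∃ y, y ∈ O ∧ y ∈ F k ∧ R.Reachable x y)
    (hUni : ∀ k x x', Crs k x → Crs k x' → R.Reachable x x') (i j : ι) :
    ∀ {u v : V} (W : G.Walk u v), v ∈ I i → u ∉ I i →
      (u ∈ O → ∃ x' m, x' ∈ O ∧ (∃ y, y ∈ I m ∧ H.Adj x' y) ∧ R.Reachable u x' ∧ m ≠ i ∧
        (m = j ∨ ∃ x'' e, Crs j x'' ∧ Crs m e ∧ R.Reachable x'' e)) →
      (∀ m, u ∈ I m → (m = j ∨ ∃ x'' e, Crs j x'' ∧ Crs m e ∧ R.Reachable x'' e)) →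
      ∃ a x', Crs i a ∧ Crs j x' ∧ R.Reachable a x' := by
  intro u v W
  induction W with
  | nil => exact fun hv hu _ _ => (hu hv).elim
  | cons h W' ih =>
    rename_i u u' v
    intro hv hu hOu hIu
    by_cases hu'i : u' ∈ I i
    · have huO : u ∈ O := mem_out_of_adj_inner hO hIF hrim (hGH h) hu'i hu
      obtain ⟨x', m, hx'O, ⟨y, hyI, hxy⟩, hux', hmi, hlink⟩ := hOu huO
      have hCu : Crs i u :=
        (hCrs i u).2 ⟨huO, ⟨u', hu'i, hGH h⟩, x', hx'O, hrim hmi.symm hxy hyI, hux'⟩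
      have hCx' : Crs m x' :=
        (hCrs m x').2 ⟨hx'O, ⟨y, hyI, hxy⟩, u, huO, hrim hmi (hGH h) hu'i, hux'.symm⟩
      obtain ⟨x'', hx'', hRx⟩ := exists_crs_reachable_of_linked hUni hlink hCx'
      exact ⟨u, x'', hCu, hx'', hux'.trans hRx.symm⟩
    · refine ih hv hu'i ?_ ?_
      · intro hu'O
        by_cases huO : u ∈ O
        · obtain ⟨x', m, hx'O, hrimx, hux', hmi, hlink⟩ := hOu huO
          exact ⟨x', m, hx'O, hrimx, (hR h.symm hu'O huO).reachable.trans hux', hmi, hlink⟩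
        · rw [hO] at huO
          push Not at huO
          obtain ⟨m, hm⟩ := huO
          have hmi : m ≠ i := fun hmi => hu (hmi ▸ hm)
          exact ⟨u', m, hu'O, ⟨u, hm, hGH h.symm⟩, Reachable.refl _, hmi, hIu m hm⟩
      · intro m hm'
        by_cases huO : u ∈ O
        · obtain ⟨x', m', hx'O, ⟨y, hyI, hxy⟩, hux', -, hlink⟩ := hOu huO
          by_cases hmm : m' = m
          · exact hmm ▸ hlink
          · have hCx' : Crs m' x' :=
              (hCrs m' x').2 ⟨hx'O, ⟨y, hyI, hxy⟩, u, huO, hrim hmm (hGH h) hm', hux'.symm⟩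
            have hCu : Crs m u :=
              (hCrs m u).2 ⟨huO, ⟨u', hm', hGH h⟩, x', hx'O, hrim (Ne.symm hmm) hxy hyI, hux'⟩
            obtain ⟨x'', hx'', hRx⟩ := exists_crs_reachable_of_linked hUni hlink hCx'
            exact Or.inr ⟨x'', u, hx'', hCu, hRx.trans hux'.symm⟩
        · rw [hO] at huO
          push Not at huO
          obtain ⟨m₀, hm₀⟩ := huO
          have hmm : m₀ = m := by
            by_contra hne
            exact hIF m₀ u hm₀ (hrim hne (hGH h) hm')
          exact hIu m (hmm ▸ hm₀)

/-- **A walk between two distinct inner sets yields joined crossing sites** (under uniqueness of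
the crossing clusters): if all crossing sites of each index are `R`-joined, a `G`-walk from `I j`
to `I i` with `j ≠ i` produces a crossing site of `i` and a crossing site of `j` that are
`R`-joined (first-exit / last-entry decomposition of the walk at the inner sets: every maximal
excursion outside the inner sets between two distinct inner sets starts and ends at crossing
sites). [folklore] -/
theorem exists_crs_pair_of_walk (hGH : G ≤ H)
    (hR : ∀ ⦃a b : V⦄, G.Adj a b → a ∈ O → b ∈ O → R.Adj a b)
    (hO : ∀ x, x ∈ O ↔ ∀ k, x ∉ I k) (hIF : ∀ k x, x ∈ I k → x ∈ F k → False)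
    (hfar : ∀ ⦃k m : ι⦄, k ≠ m → I m ⊆ F k)
    (hrim : ∀ ⦃k m : ι⦄, k ≠ m → ∀ ⦃x y : V⦄, H.Adj x y → y ∈ I m → x ∈ F k)
    (hCrs : ∀ k x, Crs k x ↔
      x ∈ O ∧ (∃ y, y ∈ I k ∧ H.Adj x y) ∧ ∃ y, y ∈ O ∧ y ∈ F k ∧ R.Reachable x y)
    (hUni : ∀ k x x', Crs k x → Crs k x' → R.Reachable x x') {i j : ι} (hji : j ≠ i)
    {u v : V} (W : G.Walk u v) (hu : u ∈ I j) (hv : v ∈ I i) :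
    ∃ a x', Crs i a ∧ Crs j x' ∧ R.Reachable a x' := by
  refine exists_crs_pair_of_walk_aux hGH hR hO hIF hrim hCrs hUni i j W hv
    (fun hui => hIF j u hu (hfar hji hui)) (fun huO => ?_) (fun m hm => ?_)
  · exact (((hO u).1 huO) j hu).elim
  · by_cases hmj : m = j
    · exact Or.inl hmj
    · exact (hIF j u hu (hfar (fun h => hmj h.symm) hm)).elim

end Excursions

section Transfer

/-- **Point pattern = crossing-cluster pattern.** Given points `P k ∈ I k` each joined by `G` to
its far set (arms), open edges inside lattice edges (`G ≤ H`), `R` = the open edges with both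
ends in `O` (`hR`, `hRG`), far-apart inner sets (`hIF`, `hfar`, `hrim`) and uniqueness of the
crossing clusters (`hUni`): two points are `G`-joined iff some crossing sites of their indices
are `R`-joined. [folklore] -/
theorem reachable_points_iff_crs (hGH : G ≤ H) (hRG : R ≤ G)
    (hR : ∀ ⦃a b : V⦄, G.Adj a b → a ∈ O → b ∈ O → R.Adj a b)
    (hO : ∀ x, x ∈ O ↔ ∀ k, x ∉ I k) (hIF : ∀ k x, x ∈ I k → x ∈ F k → False)
    (hfar : ∀ ⦃k m : ι⦄, k ≠ m → I m ⊆ F k)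
    (hrim : ∀ ⦃k m : ι⦄, k ≠ m → ∀ ⦃x y : V⦄, H.Adj x y → y ∈ I m → x ∈ F k)
    (hCrs : ∀ k x, Crs k x ↔
      x ∈ O ∧ (∃ y, y ∈ I k ∧ H.Adj x y) ∧ ∃ y, y ∈ O ∧ y ∈ F k ∧ R.Reachable x y)
    (hUni : ∀ k x x', Crs k x → Crs k x' → R.Reachable x x')
    (P : ι → V) (hP : ∀ k, P k ∈ I k) (harm : ∀ k, ∃ y, y ∈ F k ∧ G.Reachable (P k) y)
    (i j : ι) :
    G.Reachable (P i) (P j) ↔ ∃ x x', Crs i x ∧ Crs j x' ∧ R.Reachable x x' := by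
  classical
  have hpt : ∀ k, ∃ a, Crs k a ∧ G.Reachable (P k) a := by
    intro k
    obtain ⟨y, hyF, ⟨W⟩⟩ := harm k
    obtain ⟨a, ha, hCa⟩ := exists_crs_mem_support_of_walk_far hGH hR hO hIF hrim hCrs W (hP k) hyF
    exact ⟨a, hCa, ⟨W.takeUntil a ha⟩⟩
  constructor
  · rintro ⟨W⟩
    by_cases hij : i = j
    · subst hij
      obtain ⟨a, hCa, -⟩ := hpt i
      exact ⟨a, a, hCa, hCa, Reachable.refl _⟩
    · obtain ⟨a, x', hCa, hCx', hax⟩ :=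
        exists_crs_pair_of_walk hGH hR hO hIF hfar hrim hCrs hUni hij W (hP i) (hP j)
      exact ⟨x', a, hCx', hCa, hax.symm⟩
  · rintro ⟨x, x', hx, hx', hxx'⟩
    obtain ⟨a, hCa, hPa⟩ := hpt i
    obtain ⟨a', hCa', hPa'⟩ := hpt j
    exact hPa.trans ((((hUni i a x hCa hx).trans hxx').trans (hUni j x' a' hx' hCa')).mono hRG)
      |>.trans hPa'.symm

/-- **Ball pattern = crossing-cluster pattern.** Same as `reachable_points_iff_crs` with "some
vertex of the inner set" in place of a chosen point: given an arm from every inner set to its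
far set and uniqueness of the crossing clusters, `I i` and `I j` are `G`-joined iff some crossing
sites of `i` and `j` are `R`-joined. [folklore] -/
theorem reachable_inner_iff_crs (hGH : G ≤ H) (hRG : R ≤ G)
    (hR : ∀ ⦃a b : V⦄, G.Adj a b → a ∈ O → b ∈ O → R.Adj a b)
    (hO : ∀ x, x ∈ O ↔ ∀ k, x ∉ I k) (hIF : ∀ k x, x ∈ I k → x ∈ F k → False)
    (hfar : ∀ ⦃k m : ι⦄, k ≠ m → I m ⊆ F k)
    (hrim : ∀ ⦃k m : ι⦄, k ≠ m → ∀ ⦃x y : V⦄, H.Adj x y → y ∈ I m → x ∈ F k)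
    (hCrs : ∀ k x, Crs k x ↔
      x ∈ O ∧ (∃ y, y ∈ I k ∧ H.Adj x y) ∧ ∃ y, y ∈ O ∧ y ∈ F k ∧ R.Reachable x y)
    (hUni : ∀ k x x', Crs k x → Crs k x' → R.Reachable x x')
    (harm : ∀ k, ∃ x y, x ∈ I k ∧ y ∈ F k ∧ G.Reachable x y) (i j : ι) :
    (∃ x y, x ∈ I i ∧ y ∈ I j ∧ G.Reachable x y) ↔
      ∃ x x', Crs i x ∧ Crs j x' ∧ R.Reachable x x' := by
  classical
  have hpt : ∀ k, ∃ u a, u ∈ I k ∧ Crs k a ∧ G.Reachable u a := by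
    intro k
    obtain ⟨u, y, hu, hyF, ⟨W⟩⟩ := harm k
    obtain ⟨a, ha, hCa⟩ := exists_crs_mem_support_of_walk_far hGH hR hO hIF hrim hCrs W hu hyF
    exact ⟨u, a, hu, hCa, ⟨W.takeUntil a ha⟩⟩
  constructor
  · rintro ⟨u, v, hu, hv, ⟨W⟩⟩
    by_cases hij : i = j
    · subst hij
      obtain ⟨-, a, -, hCa, -⟩ := hpt i
      exact ⟨a, a, hCa, hCa, Reachable.refl _⟩
    · obtain ⟨a, x', hCa, hCx', hax⟩ :=
        exists_crs_pair_of_walk hGH hR hO hIF hfar hrim hCrs hUni hij W hu hv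
      exact ⟨x', a, hCx', hCa, hax.symm⟩
  · rintro ⟨x, x', hx, hx', hxx'⟩
    obtain ⟨u, a, hu, hCa, hPa⟩ := hpt i
    obtain ⟨u', a', hu', hCa', hPa'⟩ := hpt j
    exact ⟨u, u', hu, hu', hPa.trans
      ((((hUni i a x hCa hx).trans hxx').trans (hUni j x' a' hx' hCa')).mono hRG) |>.trans hPa'.symm⟩

end Transfer

end Literature.Probability.Percolation
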